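import Mathlib
import Summits.QuantumFields.YangMills.Theorems.FradkinShenkerFlowClusteringToYangMillsStubReconstructibleGeometry
import HarnessLib

/-!
# Stub `stub_obsGeometry` of crux `ContinuumLegGivenGap` (stmt-QuantumFields-15828), line `Sketch` (reshape 17-RP)

Observable geometry on the odd torus `(ℤ/(2S+1))⁴` — the elementary bookkeeping that puts a pair of
local gauge-invariant lattice observables into reflected position for the reflection-positivity
core of reshape 17:

* (i) the connected time correlation `latticeConnectedCorr` is invariant under a simultaneous
  Euclidean time translation `θ_{-c e₀} = configShift (-(c e₀))` of both observables (the periodic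
  lift intertwines `configShift` with the torus translation `torusConfigShift`, under which the
  torus Wilson state is invariant: `wilsonMeasure_map_torusConfigShift`);
* (ii) translating the second observable by `m` units adds `m` to the time separation;
* (iii) a time translate and (iv) the bond time reflection `Θ = gaugeTimeReflect` of a local
  gauge-invariant observable (`YMSpecies G = LocalGaugeObservable 4 G`) are local gauge-invariant
  observables on the translated / reflected supports (`θ_v (U^g) = (θ_v U)^{g(· - v)}`,
  `Θ (U^g) = (Θ U)^{g ∘ θ}`);
* (v) a time translate of a cylinder observable is a cylinder observable on the translated support.

**Sources.** K. Osterwalder, E. Seiler, Ann. Phys. 110 (1978) 440, §2; E. Seiler, LNP 159 (1982),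
Ch. 2; J. Glimm, A. Jaffe, *Quantum Physics* (1987), §6.1.
-/

noncomputable section

open Filter Topology MeasureTheory
open Literature.MathematicalPhysics.QuantumFieldTheory Literature.MathematicalPhysics.QuantumLattice
  Literature.MathematicalPhysics.AQFT Literature.Probability.LatticeModels
open Summit.QuantumFields.YangMills.Theorems.ClusteringToYangMills

namespace Summit.QuantumFields.YangMills.Theorems.ContinuumLegGivenGap

/-! ### Translations of `ℤ⁴` gauge fields: composition, periodic lift, cylinder observables -/

section ShiftGeometry

variable {G : Type} [MeasurableSpace G]

/-- Translations of `ℤ⁴` gauge configurations compose additively, `θ_{a+b} = θ_a ∘ θ_b`. [folklore] -/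
theorem obsGeometry_configShift_add (a b : Literature.Probability.LatticeModels.Site 4)
    (U : LGConfig 4 G) : configShift (a + b) U = configShift a (configShift b U) := by
  funext e
  simp only [Literature.MathematicalPhysics.QuantumLattice.configShift_apply, sub_sub]

/-- Time translations of `ℤ⁴` gauge configurations commute. [folklore] -/
theorem obsGeometry_configShift_comm (a b : Literature.Probability.LatticeModels.Site 4)
    (U : LGConfig 4 G) : configShift a (configShift b U) = configShift b (configShift a U) := by
  rw [← obsGeometry_configShift_add, ← obsGeometry_configShift_add, add_comm]

/-- Two successive time translations by `-m e₀` and `-n e₀` are the translation by `-(n+m) e₀`. [folklore] -/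
theorem obsGeometry_configShift_neg_single_natCast (m n : ℕ) (U : LGConfig 4 G) :
    configShift (-(Pi.single 0 (m : ℤ))) (configShift (-(Pi.single 0 (n : ℤ))) U) =
      configShift (-(Pi.single (0 : Fin 4) ((n + m : ℕ) : ℤ))) U := by
  rw [← obsGeometry_configShift_add, Nat.cast_add, Pi.single_add, neg_add_rev]

/-- The periodic lift intertwines the translations of `ℤ⁴` with the torus translations:
`θ_w (Ũ) = (T_{w mod L} U)~`. [folklore] -/
theorem obsGeometry_configShift_torusLift {L : ℕ} (w : Literature.Probability.LatticeModels.Site 4)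
    (U : GaugeConfig 4 L G) :
    configShift w (torusLift L U) = torusLift L (torusConfigShift (Torus.proj L w) U) :=
  congrFun (toTorusObservable_comp_configShift (G := G) L w id) U

/-- **(v)** A time translate of a cylinder observable is a cylinder observable on the translated
support: `F ∘ θ_{-c e₀}` depends only on the links `(x + c e₀, i)`, `(x, i) ∈ Λ`. [folklore] -/
theorem obsGeometry_isCylinder_comp_configShift {α : Type*} {F : LGConfig 4 G → α}
    {Λ : Finset (Literature.MathematicalPhysics.QuantumLattice.ZdEdge 4)} (c : ℤ) (hF : IsCylinder F Λ) :
    IsCylinder (F ∘ configShift (-(Pi.single 0 c))) (Λ.image (fun e => (e.1 + Pi.single 0 c, e.2))) := by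
  intro U V hUV
  simp only [Function.comp_apply]
  refine hF fun e he => ?_
  rw [Literature.MathematicalPhysics.QuantumLattice.configShift_apply,
    Literature.MathematicalPhysics.QuantumLattice.configShift_apply, sub_neg_eq_add]
  exact hUV _ (Finset.mem_coe.2 (Finset.mem_image_of_mem _ (Finset.mem_coe.1 he)))

end ShiftGeometry

/-! ### Gauge covariance of translations and of the bond reflection -/

section Gauge

variable {G : Type} [Group G]

/-- Translation intertwines gauge transformations (any group `G`):
`θ_v (U^g) = (θ_v U)^{g(· - v)}`. [folklore] -/
theorem obsGeometry_configShift_gaugeTransformZd [MeasurableSpace G]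
    (v : Literature.Probability.LatticeModels.Site 4) (g : Literature.Probability.LatticeModels.Site 4 → G)
    (U : LGConfig 4 G) :
    configShift v (gaugeTransformZd g U) = gaugeTransformZd (fun y => g (y - v)) (configShift v U) := by
  funext e
  simp only [Literature.MathematicalPhysics.QuantumLattice.configShift_apply, gaugeTransformZd, add_sub_right_comm]

/-- A translate of a gauge-invariant observable is gauge invariant (any group `G`). [folklore] -/
theorem obsGeometry_isZdGaugeInvariant_comp_configShift [MeasurableSpace G] {α : Type*}
    {F : LGConfig 4 G → α} (hF : IsZdGaugeInvariant F) (v : Literature.Probability.LatticeModels.Site 4) :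
    IsZdGaugeInvariant (F ∘ configShift v) := by
  intro g U
  simp only [Function.comp_apply, obsGeometry_configShift_gaugeTransformZd]
  exact hF _ _

/-- `θ (x + eᵢ) = θ x + eᵢ` for a spatial direction `i ≠ 0` (`θ : x₀ ↦ -1 - x₀`). [folklore] -/
theorem obsGeometry_latticeTimeReflection_add_single (x : Literature.Probability.LatticeModels.Site 4)
    {i : Fin 4} (hi : i ≠ 0) :
    latticeTimeReflection 4 (x + Pi.single i 1) = latticeTimeReflection 4 x + Pi.single i 1 := by
  ext j
  by_cases hj : j = 0
  · subst hj; simp [hi.symm]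
  · by_cases hji : j = i
    · subst hji; simp [hj]
    · simp [hj, Pi.single_apply, hji]

/-- **The bond reflection intertwines gauge transformations**: `Θ (U^g) = (Θ U)^{g ∘ θ}`. [folklore] -/
theorem obsGeometry_gaugeTimeReflect_gaugeTransformZd (g : Literature.Probability.LatticeModels.Site 4 → G)
    (U : LGConfig 4 G) :
    gaugeTimeReflect (gaugeTransformZd g U) =
      gaugeTransformZd (g ∘ latticeTimeReflection 4) (gaugeTimeReflect U) := by
  funext e
  obtain ⟨x, i⟩ := e
  by_cases h : i = 0
  · subst h
    simp only [gaugeTimeReflect_apply, ↓reduceIte, gaugeTransformZd, Function.comp_apply, mul_inv_rev,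
      inv_inv, Reconstructible.latticeTimeReflection_add_add, mul_assoc]
  · simp only [gaugeTimeReflect_apply, h, ↓reduceIte, gaugeTransformZd, Function.comp_apply,
      obsGeometry_latticeTimeReflection_add_single x h]

/-- The reflection `F ∘ Θ` of a gauge-invariant observable is gauge invariant. [folklore] -/
theorem obsGeometry_isZdGaugeInvariant_comp_gaugeTimeReflect {α : Type*} {F : LGConfig 4 G → α}
    (hF : IsZdGaugeInvariant F) : IsZdGaugeInvariant (F ∘ gaugeTimeReflect) := by
  intro g U
  simp only [Function.comp_apply, obsGeometry_gaugeTimeReflect_gaugeTransformZd]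
  exact hF _ _

variable [MeasurableSpace G]

/-- **(iii)** A time translate of a local gauge-invariant observable is a local gauge-invariant
observable on the translated support. [folklore] -/
theorem obsGeometry_species_shift (A : YMSpecies G) (c : ℤ) :
    ∃ A' : YMSpecies G, A'.F = A.F ∘ configShift (-(Pi.single 0 c)) ∧
      A'.supp = A.supp.image (fun e => (e.1 + Pi.single 0 c, e.2)) := by
  obtain ⟨C, hC⟩ := A.bounded
  -- the proof fields are given after `refine`, once `F` and `supp` are fully elaborated
  refine ⟨⟨A.F ∘ configShift (-(Pi.single 0 c)), A.supp.image (fun e => (e.1 + Pi.single 0 c, e.2)),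
    ?_, ?_, ?_, ?_⟩, ?_, ?_⟩
  · exact obsGeometry_isCylinder_comp_configShift c A.isCylinder
  · exact obsGeometry_isZdGaugeInvariant_comp_configShift A.gaugeInvariant _
  · exact ⟨C, fun U => hC _⟩
  · exact A.measurable.comp (Literature.MathematicalPhysics.QuantumLattice.configShift _).measurable
  · rfl
  · rfl

/-- **(iv)** The bond time reflection of a local gauge-invariant observable is a local
gauge-invariant observable on the reflected support (`MeasurableInv G` for the measurability of
`Θ`, which inverts the temporal links). [folklore] -/
theorem obsGeometry_species_reflect [MeasurableInv G] (A : YMSpecies G) :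
    ∃ A' : YMSpecies G, A'.F = A.F ∘ gaugeTimeReflect ∧
      A'.supp = A.supp.image (fun e => if e.2 = 0 then (latticeTimeReflection 4 (e.1 + Pi.single 0 1), 0)
        else (latticeTimeReflection 4 e.1, e.2)) := by
  obtain ⟨C, hC⟩ := A.bounded
  refine ⟨⟨A.F ∘ gaugeTimeReflect,
    A.supp.image (fun e => if e.2 = 0 then (latticeTimeReflection 4 (e.1 + Pi.single 0 1), 0)
      else (latticeTimeReflection 4 e.1, e.2)), ?_, ?_, ?_, ?_⟩, ?_, ?_⟩
  · exact Reconstructible.isCylinder_comp_gaugeTimeReflect A.isCylinder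
  · exact obsGeometry_isZdGaugeInvariant_comp_gaugeTimeReflect A.gaugeInvariant
  · exact ⟨C, fun U => hC _⟩
  · exact A.measurable.comp Reconstructible.measurable_gaugeTimeReflect
  · rfl
  · rfl

end Gauge

/-! ### Translation invariance of the connected time correlations on the torus -/

section Corr

variable {G : Type} [Group G] [TopologicalSpace G] [IsTopologicalGroup G] [CompactSpace G]
  [MeasurableSpace G] [BorelSpace G] {N : ℕ} (ρ : G →* Matrix (Fin N) (Fin N) ℂ) (β : ℝ)

/-- Torus Wilson integrals are translation invariant (any integrand: `T_v` is a measurable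
equivalence preserving `wilsonMeasure`). [folklore] -/
theorem obsGeometry_integral_comp_torusConfigShift {L : ℕ} [NeZero L] (v : Site 4 L)
    (f : GaugeConfig 4 L G → ℝ) :
    ∫ U, f (torusConfigShift v U) ∂(wilsonMeasure (d := 4) (L := L) ρ β) =
      ∫ U, f U ∂(wilsonMeasure (d := 4) (L := L) ρ β) := by
  rw [← integral_map_equiv, wilsonMeasure_map_torusConfigShift]

/-- Torus Wilson integrals of lifted observables are invariant under translations of `ℤ⁴`. [folklore] -/
theorem obsGeometry_integral_torusLift_configShift {L : ℕ} [NeZero L]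
    (w : Literature.Probability.LatticeModels.Site 4) (F : LGConfig 4 G → ℝ) :
    ∫ U, F (configShift w (torusLift L U)) ∂(wilsonMeasure (d := 4) (L := L) ρ β) =
      ∫ U, F (torusLift L U) ∂(wilsonMeasure (d := 4) (L := L) ρ β) := by
  simp_rw [obsGeometry_configShift_torusLift]
  exact obsGeometry_integral_comp_torusConfigShift ρ β _ fun V => F (torusLift L V)

/-- **(i)** The connected time correlation is invariant under a simultaneous time translation of
the pair of observables. [folklore] -/
theorem obsGeometry_corr_comp_configShift (A B : LGConfig 4 G → ℝ) (c : ℤ) (S n : ℕ) :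
    latticeConnectedCorr ρ β (2 * S + 1) (A ∘ configShift (-(Pi.single 0 c)))
        (B ∘ configShift (-(Pi.single 0 c))) n =
      latticeConnectedCorr ρ β (2 * S + 1) A B n := by
  unfold latticeConnectedCorr
  simp only [Function.comp_apply]
  rw [obsGeometry_integral_torusLift_configShift ρ β _ A,
    obsGeometry_integral_torusLift_configShift ρ β _ B]
  congr 1
  simp_rw [obsGeometry_configShift_comm (-(Pi.single 0 c)) (-(Pi.single 0 (n : ℤ)))]
  exact obsGeometry_integral_torusLift_configShift ρ β _
    fun V => A V * B (configShift (-(Pi.single 0 (n : ℤ))) V)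

/-- **(ii)** Translating the second observable by `m` units of Euclidean time adds `m` to the
separation. [folklore] -/
theorem obsGeometry_corr_comp_configShift_right (A B : LGConfig 4 G → ℝ) (m n S : ℕ) :
    latticeConnectedCorr ρ β (2 * S + 1) A (B ∘ configShift (-(Pi.single 0 (m : ℤ)))) n =
      latticeConnectedCorr ρ β (2 * S + 1) A B (n + m) := by
  unfold latticeConnectedCorr
  simp only [Function.comp_apply]
  rw [obsGeometry_integral_torusLift_configShift ρ β _ B]
  simp_rw [obsGeometry_configShift_neg_single_natCast]

end Corr

/-- `stub_obsGeometry` — **observable geometry on the torus** (reshape 17 glue, elementary): (i) connected time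
correlations are invariant under a simultaneous Euclidean time translation of the pair (torus translation
invariance); (ii) translating the second observable by `m ≥ 0` units adds `m` to the separation; (iii) a time
translate and (iv) the bond time reflection of a local gauge-invariant observable (`YMSpecies`) are local
gauge-invariant observables with the translated / reflected supports (`θ_v (U^g) = (θ_v U)^{g(· - v)}`;
`Θ(U^g) = (ΘU)^{g∘θ}`); (v) a time translate of a cylinder observable is a cylinder observable on the translated
support. [folklore] -/
theorem stub_obsGeometry :
    ∀ (G : Type) [Group G] [TopologicalSpace G] [IsTopologicalGroup G] [CompactSpace G]
      [MeasurableSpace G] [BorelSpace G] (r : LatticeRep G),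
      ∀ (β : ℝ),
      (∀ (A B : LGConfig 4 G → ℝ), Measurable A → Measurable B → (∃ C : ℝ, ∀ U, |A U| ≤ C) →
        (∃ C : ℝ, ∀ U, |B U| ≤ C) → ∀ (c : ℤ) (S n : ℕ),
        latticeConnectedCorr r.ρ β (2 * S + 1) (A ∘ configShift (-(Pi.single 0 c)))
            (B ∘ configShift (-(Pi.single 0 c))) n =
          latticeConnectedCorr r.ρ β (2 * S + 1) A B n) ∧
      (∀ (A B : LGConfig 4 G → ℝ), Measurable A → Measurable B → (∃ C : ℝ, ∀ U, |A U| ≤ C) →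
        (∃ C : ℝ, ∀ U, |B U| ≤ C) → ∀ (m n S : ℕ),
        latticeConnectedCorr r.ρ β (2 * S + 1) A (B ∘ configShift (-(Pi.single 0 (m : ℤ)))) n =
          latticeConnectedCorr r.ρ β (2 * S + 1) A B (n + m)) ∧
      (∀ (A : YMSpecies G) (c : ℤ), ∃ A' : YMSpecies G,
        A'.F = A.F ∘ configShift (-(Pi.single 0 c)) ∧
          A'.supp = A.supp.image (fun e => (e.1 + Pi.single 0 c, e.2))) ∧
      (∀ A : YMSpecies G, ∃ A' : YMSpecies G,
        A'.F = A.F ∘ gaugeTimeReflect ∧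
          A'.supp = A.supp.image (fun e => if e.2 = 0 then (latticeTimeReflection 4 (e.1 + Pi.single 0 1), 0)
            else (latticeTimeReflection 4 e.1, e.2))) ∧
      (∀ (F : LGConfig 4 G → ℝ) (Λ : Finset (Literature.MathematicalPhysics.QuantumLattice.ZdEdge 4)) (c : ℤ), IsCylinder F Λ →
        IsCylinder (F ∘ configShift (-(Pi.single 0 c))) (Λ.image (fun e => (e.1 + Pi.single 0 c, e.2)))) := by
  intro G _ _ _ _ _ _ r β
  exact ⟨fun A B _ _ _ _ c S n => obsGeometry_corr_comp_configShift r.ρ β A B c S n,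
    fun A B _ _ _ _ m n S => obsGeometry_corr_comp_configShift_right r.ρ β A B m n S,
    fun A c => obsGeometry_species_shift A c,
    fun A => obsGeometry_species_reflect A,
    fun F Λ c hF => obsGeometry_isCylinder_comp_configShift c hF⟩

end Summit.QuantumFields.YangMills.Theorems.ContinuumLegGivenGap

end
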